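import Summits.ValiantsHypothesis.ValiantsHypothesis.Theorems.KPlusLogSqLawTropicalBParabolaCriterion

/-!
# Route «KPlusLogSqLaw» — the ENVELOPE (CHORD) CRITERION for dominant chains: a closed-form dominance certificate with
# ARBITRARY convex costs (the parabola criterion freed from its bounded-gap hypothesis, as needed on TOWER supports)

Helper file (prover leafhand-val-kpluslogsqlaw-1 g3, 2026-08-31) for the design seats of the cruxes `TropicalB` (stmt-ValiantsHypothesis-19771)
and `WeakLifting` (stmt-ValiantsHypothesis-19561, LINE (B) `tower_graft`, `m = 2` rung).  A CONSTRUCTIVE tool valid at every format; it proves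
no census bound and nothing on `TropicalB`, `WeakLifting`, `MatrixDescartes` (18050) or `VP ≠ VNP`.

In the `(slope, cost)` plane (`tropWeight d v θ q = θ·slope q − cost q`) the dominant terms along increasing `θ` are the vertices of the LOWER
convex hull of the present terms.  The tree's `isDominant_of_parabola` (p440741) certifies a chain whose points lie on ONE parabola with every
other term at a uniform depth `D > (G−1)²/4` below, `G` the largest slope gap — unusable on tower supports, whose slope gaps range over all
scales.  The chord criterion replaces the parabola by the chain's own piecewise-linear interpolation:

* `isDominant_of_envelope` — chain terms `p₀,…,p_n` with strictly increasing slopes `x_k` and costs `I_k` satisfying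
  `I_{k+1} = I_k + t_{k+1}·(x_{k+1} − x_k)` for integer «crossing times» with `t_k + 2 ≤ t_{k+1}`; if every other PRESENT term
  `q` has its slope in some chain interval `[x_j, x_{j+1}]` and its cost STRICTLY ABOVE THE CHORD, `cost q > I_j + t_{j+1}(slope q − x_j)`,
  then `p_k` is the unique optimum at the integer slope `θ_k = t_k + 1` (strictly increasing in `k`).
* `tropRootLawAt_false_of_envelope` — with alternating signs this refutes `TropRootLawAt m K B` for `B < n`.

PROOF: a line strictly above the chord of two chain lines is strictly below their maximum everywhere (compare with the left line before the
crossing time and with the right line after it); chain line `k` beats chain line `j` at `t_k + 1` by the telescoped bounds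
`t_{j+1}(x_k − x_j) ≤ I_k − I_j ≤ t_k (x_k − x_j)` (`j ≤ k`).  [folklore] lower convex hulls; elementary.
-/

set_option linter.dupNamespace false
set_option autoImplicit false

namespace Summit.ValiantsHypothesis.ValiantsHypothesis.Theorems.KPlusLogSqLaw

open Summit.ValiantsHypothesis.ValiantsHypothesis.Theorems.MatrixDescartes.Negative
open Summit.ValiantsHypothesis.ValiantsHypothesis.Theorems.LacunarySymmetroidMatrixDescartes
open Summit.ValiantsHypothesis.ValiantsHypothesis.Theorems.LacunarySymmetroidMatrixDescartes.TropicalCensus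
open Finset

namespace EnvelopeCriterion

/-- monotone copies: `X j ≤ X k` for `j ≤ k ≤ N` from the successor steps. [folklore] -/
theorem mono_of_succ (X : ℕ → ℤ) (N : ℕ) (hX : ∀ i, i + 1 ≤ N → X i ≤ X (i + 1)) :
    ∀ j k, j ≤ k → k ≤ N → X j ≤ X k := by
  intro j k hjk hkN
  induction k with
  | zero =>
    have : j = 0 := by omega
    subst this; exact le_rfl
  | succ k ih =>
    rcases Nat.eq_or_lt_of_le hjk with rfl | hlt
    · exact le_rfl
    · exact (ih (by omega) (by omega)).trans (hX k (by omega))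

/-- telescoped UPPER bound: with increasing times, `I k − I j ≤ T k · (X k − X j)` for `j ≤ k`. [folklore] -/
theorem cost_sub_le (X I T : ℕ → ℤ) (N : ℕ) (hX : ∀ i, i + 1 ≤ N → X i ≤ X (i + 1)) (hT : ∀ i, i + 1 ≤ N → T i ≤ T (i + 1))
    (hI : ∀ i, i + 1 ≤ N → I (i + 1) = I i + T (i + 1) * (X (i + 1) - X i)) :
    ∀ j k, j ≤ k → k ≤ N → I k - I j ≤ T k * (X k - X j) := by
  intro j k hjk hkN
  induction k with
  | zero =>
    have : j = 0 := by omega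
    subst this; simp
  | succ k ih =>
    rcases Nat.eq_or_lt_of_le hjk with rfl | hlt
    · simp
    · have h1 := ih (by omega) (by omega)
      have hXk : X j ≤ X k := mono_of_succ X N hX j k (by omega) (by omega)
      have hTk := hT k (by omega)
      have hXk1 := hX k (by omega)
      rw [hI k (by omega)]
      nlinarith [mul_le_mul_of_nonneg_right hTk (sub_nonneg.mpr hXk)]

/-- telescoped LOWER bound: `T (j+1) · (X k − X j) ≤ I k − I j` for `j ≤ k`. [folklore] -/
theorem le_cost_sub (X I T : ℕ → ℤ) (N : ℕ) (hX : ∀ i, i + 1 ≤ N → X i ≤ X (i + 1)) (hT : ∀ i, i + 1 ≤ N → T i ≤ T (i + 1))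
    (hI : ∀ i, i + 1 ≤ N → I (i + 1) = I i + T (i + 1) * (X (i + 1) - X i)) :
    ∀ j k, j ≤ k → k ≤ N → T (j + 1) * (X k - X j) ≤ I k - I j := by
  intro j k hjk hkN
  induction k with
  | zero =>
    have : j = 0 := by omega
    subst this; simp
  | succ k ih =>
    rcases Nat.eq_or_lt_of_le hjk with rfl | hlt
    · simp
    · have h1 := ih (by omega) (by omega)
      have hTjk : T (j + 1) ≤ T (k + 1) := mono_of_succ T N hT (j + 1) (k + 1) (by omega) (by omega)
      have hXk1 := hX k (by omega)
      rw [hI k (by omega)]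
      nlinarith [mul_le_mul_of_nonneg_right hTjk (sub_nonneg.mpr hXk1)]

/-- **a line strictly above a chord lies strictly below the maximum of the two chord lines, everywhere.** [folklore] -/
theorem line_lt_max_of_above_chord {s x₁ x₂ J I₁ t θ : ℤ} (h1 : x₁ ≤ s) (h2 : s ≤ x₂)
    (hJ : I₁ + t * (s - x₁) < J) :
    θ * s - J < max (θ * x₁ - I₁) (θ * x₂ - (I₁ + t * (x₂ - x₁))) := by
  rcases le_or_gt θ t with hθ | hθ
  · -- before the crossing time: compare with the left line
    refine lt_of_lt_of_le ?_ (le_max_left _ _)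
    nlinarith [mul_le_mul_of_nonneg_right hθ (sub_nonneg.mpr h1)]
  · refine lt_of_lt_of_le ?_ (le_max_right _ _)
    nlinarith [mul_le_mul_of_nonneg_right hθ.le (sub_nonneg.mpr h2)]

/-- **ENVELOPE (CHORD) CRITERION.**  Chain terms with strictly increasing slopes `x_k`, costs `I_k` linked by crossing times `t_k`
(`I_{k+1} = I_k + t_{k+1}(x_{k+1} − x_k)`, `t_k + 2 ≤ t_{k+1}`), every other present term strictly above a chord: then `p_k` is the unique
optimum at `θ_k = t_k + 1`. [folklore] -/
theorem isDominant_of_envelope {m K n : ℕ} (d : Fin K → ℕ) (v ε : Fin m → Fin m → Fin K → ℤ)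
    (p : Fin (n + 1) → Equiv.Perm (Fin m) × (Fin m → Fin K)) (x I t : Fin (n + 1) → ℤ)
    (hx : ∀ k, TropicalCensus.slope d (p k) = x k) (hI : ∀ k, ∑ i, v ((p k).1 i) i ((p k).2 i) = I k)
    (hmono : StrictMono x) (ht : ∀ k : Fin n, t k.castSucc + 2 ≤ t k.succ)
    (hstep : ∀ k : Fin n, I k.succ = I k.castSucc + t k.succ * (x k.succ - x k.castSucc))
    (hpres : ∀ k, termSign ε (p k) ≠ 0)
    (hoff : ∀ q, termSign ε q ≠ 0 → (∀ k, q ≠ p k) → ∃ j : Fin n, x j.castSucc ≤ TropicalCensus.slope d q ∧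
        TropicalCensus.slope d q ≤ x j.succ ∧
        I j.castSucc + t j.succ * (TropicalCensus.slope d q - x j.castSucc) < ∑ i, v (q.1 i) i (q.2 i)) :
    ∃ θ : Fin (n + 1) → ℤ, StrictMono θ ∧ ∀ k, IsDominant d v ε (θ k) (p k) := by
  -- ℕ-indexed copies
  let X : ℕ → ℤ := fun i => if h : i < n + 1 then x ⟨i, h⟩ else 0
  let C : ℕ → ℤ := fun i => if h : i < n + 1 then I ⟨i, h⟩ else 0
  let T : ℕ → ℤ := fun i => if h : i < n + 1 then t ⟨i, h⟩ else 0
  have hXe : ∀ k : Fin (n + 1), X k = x k := fun k => by simp only [X, dif_pos k.isLt]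
  have hCe : ∀ k : Fin (n + 1), C k = I k := fun k => by simp only [C, dif_pos k.isLt]
  have hTe : ∀ k : Fin (n + 1), T k = t k := fun k => by simp only [T, dif_pos k.isLt]
  have hXlt : ∀ i j : ℕ, i < j → j < n + 1 → X i < X j := by
    intro i j hij hj
    have hi : i < n + 1 := hij.trans hj
    simp only [X, dif_pos hi, dif_pos hj]
    exact hmono (show (⟨i, hi⟩ : Fin (n + 1)) < ⟨j, hj⟩ from hij)
  have hXs : ∀ i, i + 1 ≤ n → X i ≤ X (i + 1) := fun i hi => (hXlt i (i + 1) (by omega) (by omega)).le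
  have hTs2 : ∀ i, i + 1 ≤ n → T i + 2 ≤ T (i + 1) := by
    intro i hi
    have h := ht ⟨i, by omega⟩
    have e1 : T i = t (⟨i, by omega⟩ : Fin n).castSucc := by simp only [T, dif_pos (show i < n + 1 by omega)]; rfl
    have e2 : T (i + 1) = t (⟨i, by omega⟩ : Fin n).succ := by simp only [T, dif_pos (show i + 1 < n + 1 by omega)]; rfl
    rw [e1, e2]; exact h
  have hTs : ∀ i, i + 1 ≤ n → T i ≤ T (i + 1) := fun i hi => by have := hTs2 i hi; omega
  have hCs : ∀ i, i + 1 ≤ n → C (i + 1) = C i + T (i + 1) * (X (i + 1) - X i) := by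
    intro i hi
    have h := hstep ⟨i, by omega⟩
    have eC1 : C (i + 1) = I (⟨i, by omega⟩ : Fin n).succ := by simp only [C, dif_pos (show i + 1 < n + 1 by omega)]; rfl
    have eC0 : C i = I (⟨i, by omega⟩ : Fin n).castSucc := by simp only [C, dif_pos (show i < n + 1 by omega)]; rfl
    have eT1 : T (i + 1) = t (⟨i, by omega⟩ : Fin n).succ := by simp only [T, dif_pos (show i + 1 < n + 1 by omega)]; rfl
    have eX1 : X (i + 1) = x (⟨i, by omega⟩ : Fin n).succ := by simp only [X, dif_pos (show i + 1 < n + 1 by omega)]; rfl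
    have eX0 : X i = x (⟨i, by omega⟩ : Fin n).castSucc := by simp only [X, dif_pos (show i < n + 1 by omega)]; rfl
    rw [eC1, eC0, eT1, eX1, eX0]; exact h
  have hup := cost_sub_le X C T n hXs hTs hCs
  have hlo := le_cost_sub X C T n hXs hTs hCs
  -- chain line `j` is at most chain line `k` at `θ_k = T k + 1`, strictly unless `j = k`
  have chain_le : ∀ j k : ℕ, j < n + 1 → k < n + 1 → (T k + 1) * X j - C j ≤ (T k + 1) * X k - C k ∧
      (j ≠ k → (T k + 1) * X j - C j < (T k + 1) * X k - C k) := by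
    intro j k hj hk
    rcases lt_trichotomy j k with hjk | rfl | hkj
    · have h := hup j k hjk.le (by omega)
      have hx := hXlt j k hjk hk
      constructor
      · nlinarith
      · intro; nlinarith
    · exact ⟨le_rfl, fun h => absurd rfl h⟩
    · have h := hlo k j hkj.le (by omega)
      have hx := hXlt k j hkj hj
      have hT2 : T k + 2 ≤ T (k + 1) := hTs2 k (by omega)
      have hTm : T (k + 1) ≤ T j := mono_of_succ T n hTs (k + 1) j (by omega) (by omega)
      constructor
      · nlinarith [mul_le_mul_of_nonneg_right hTm (sub_nonneg.mpr hx.le)]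
      · intro; nlinarith [mul_le_mul_of_nonneg_right hTm (sub_nonneg.mpr hx.le)]
  let θ : Fin (n + 1) → ℤ := fun k => t k + 1
  refine ⟨θ, ?_, fun k => ⟨hpres k, fun q hq hqs => ?_⟩⟩
  · rw [Fin.strictMono_iff_lt_succ]
    intro k
    have h := ht k
    show t k.castSucc + 1 < t k.succ + 1
    omega
  · rw [tropWeight_eq_slope, tropWeight_eq_slope, hx k, hI k]
    have hθk : θ k = T k + 1 := by simp only [θ, hTe k]
    rw [hθk, ← hXe k, ← hCe k]
    by_cases hch : ∃ j, q = p j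
    · obtain ⟨j, rfl⟩ := hch
      have hjk : (j : ℕ) ≠ (k : ℕ) := fun h => hq (by rw [Fin.ext h])
      rw [hx j, hI j, ← hXe j, ← hCe j]
      exact (chain_le j k j.isLt k.isLt).2 hjk
    · push Not at hch
      obtain ⟨j, h1, h2, hJ⟩ := hoff q hqs hch
      have ej0 : x j.castSucc = X j := by rw [← hXe]; rfl
      have ej1 : x j.succ = X ((j : ℕ) + 1) := by rw [← hXe]; rfl
      have eI0 : I j.castSucc = C j := by rw [← hCe]; rfl
      have eT1 : t j.succ = T ((j : ℕ) + 1) := by rw [← hTe]; rfl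
      rw [ej0] at h1 hJ; rw [ej1] at h2; rw [eI0, eT1] at hJ
      have hlt := line_lt_max_of_above_chord (θ := T k + 1) h1 h2 hJ
      rw [← hCs j (by have := j.isLt; omega)] at hlt
      refine lt_of_lt_of_le hlt (max_le ?_ ?_)
      · exact (chain_le j k (by have := j.isLt; omega) k.isLt).1
      · exact (chain_le ((j : ℕ) + 1) k (by have := j.isLt; omega) k.isLt).1

/-- **An envelope chain with alternating signs refutes the tropical row**: under the hypotheses of `isDominant_of_envelope` plus sign
alternation and `|ε| ≤ 1`, `TropRootLawAt m K B` fails for every `B < n`. [folklore] -/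
theorem tropRootLawAt_false_of_envelope {m K n : ℕ} (d : Fin K → ℕ) (v ε : Fin m → Fin m → Fin K → ℤ)
    (p : Fin (n + 1) → Equiv.Perm (Fin m) × (Fin m → Fin K)) (x I t : Fin (n + 1) → ℤ)
    (hε : ∀ i j l, (ε i j l).natAbs ≤ 1)
    (hx : ∀ k, TropicalCensus.slope d (p k) = x k) (hI : ∀ k, ∑ i, v ((p k).1 i) i ((p k).2 i) = I k)
    (hmono : StrictMono x) (ht : ∀ k : Fin n, t k.castSucc + 2 ≤ t k.succ)
    (hstep : ∀ k : Fin n, I k.succ = I k.castSucc + t k.succ * (x k.succ - x k.castSucc))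
    (hpres : ∀ k, termSign ε (p k) ≠ 0)
    (hoff : ∀ q, termSign ε q ≠ 0 → (∀ k, q ≠ p k) → ∃ j : Fin n, x j.castSucc ≤ TropicalCensus.slope d q ∧
        TropicalCensus.slope d q ≤ x j.succ ∧
        I j.castSucc + t j.succ * (TropicalCensus.slope d q - x j.castSucc) < ∑ i, v (q.1 i) i (q.2 i))
    (halt : ∀ k : Fin n, termSign ε (p k.castSucc) * termSign ε (p k.succ) < 0)
    {B : ℕ} (hB : B < n) : ¬ TropRootLawAt m K B := by
  obtain ⟨θ, hθ, hdom⟩ := isDominant_of_envelope d v ε p x I t hx hI hmono ht hstep hpres hoff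
  intro h
  have := h d v ε n θ p hε hθ hdom halt
  omega

end EnvelopeCriterion

end Summit.ValiantsHypothesis.ValiantsHypothesis.Theorems.KPlusLogSqLaw
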